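import Summits.MatrixMultiplication.MatrixMultiplication.Theorems.SoloInformedTwistedTPPNormalForm
import Summits.MatrixMultiplication.MatrixMultiplication.Theorems.SoloInformedTwistedTPPCleaning
import HarnessLib

/-!
# Few-multiplier TPP stability, IV: the theorem (`n³ ≤ 115200·|A|¹⁰·|S|`)

Solo-informed seat (MatrixMultiplication), gen 104; dossier `paper/theoremB2.md` §7, THEOREM C2
(kernel form; the paper's orbit-counting gives `|A|⁸`, the five-term lemma of part II gives `|A|¹⁰`).

`TwistedRealization.cube_le`: if an abelian multiplier group `A` acts FIXED-POINT-FREELY on the finite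
abelian group `S` and `(a, b, d; φ, ψ)` is a twisted realization of `⟨n,n,n⟩` (parts I–III; for a
translation scheme `𝒮(S, M₀)` of Cohn–Umans 2013 §5 this is exactly a realization in the sense of
their Def. 12 with `A = M₀`), then `n³ ≤ 115200 · |A|¹⁰ · |S|`.
Consequently (part V) the rank `1 + (|S|-1)/|M₀|` of a translation scheme realizing `⟨n,n,n⟩` with
abelian fixed-point-free `M₀` is `≥ n³ / (115200 |M₀|¹¹)`: Conj. 21 of Cohn–Umans (rank `n^{2+o(1)}`)
forces `|M₀| ≥ n^{(1-o(1))/11}` there, and fails outright on all cyclotomic schemes (with part C1).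
Proof: part III gives a base triple with `≤ 3|A|⁵ n` bad cells and then clean boxes of sides
`s = ⌊n/(120|A|⁵)⌋, s, ≥ n/2`; part I embeds the box into `S`.
References: CohnUmans2013 (arXiv:1207.6528) Def. 12, §5, Conj. 21; this work (Theorem C2).
-/

noncomputable section

open scoped BigOperators
open Finset

namespace Summit.MatrixMultiplication.MatrixMultiplication.Theorems.TwistedTPP

namespace TwistedRealization

variable {A S : Type*} [AddCommGroup A] [AddCommGroup S]

/-- **THEOREM C2 (few-multiplier TPP stability).** For a twisted realization of `⟨n,n,n⟩` with an
abelian multiplier group `A` acting fixed-point-freely on `S`: `n³ ≤ 115200 · |A|¹⁰ · |S|`.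
[this work, Thm C2] -/
theorem cube_le [Fintype A] [DecidableEq A] [Fintype S] {n : ℕ}
    (R : TwistedRealization A S (Fin n) (Fin n) (Fin n))
    (hfpf : ∀ g : A, g ≠ 0 → ∀ x : S, R.sm g x = x → x = 0) :
    n ^ 3 ≤ 115200 * Fintype.card A ^ 10 * Fintype.card S := by
  set m := Fintype.card A with hm
  have hm1 : 1 ≤ m := Fintype.card_pos
  rcases Nat.eq_zero_or_pos n with rfl | hn
  · simp
  haveI : Nonempty (Fin n) := ⟨⟨0, hn⟩⟩
  have hS2 : n * n ≤ Fintype.card S := by simpa using R.card_mul_card_le_card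
  set β : ℕ := 3 * m ^ 5 with hβ
  have hβ1 : 1 ≤ β := by
    have : 1 ≤ m ^ 5 := Nat.one_le_pow _ _ hm1
    omega
  have hm10 : m ^ 5 ≤ m ^ 10 := Nat.pow_le_pow_right hm1 (by norm_num)
  obtain ⟨i₀, j₀, k₀, hgood⟩ := R.exists_good_base hn hfpf
  set s : ℕ := n / (40 * β) with hs
  have h40 : 40 * β * s ≤ n := Nat.mul_div_le n (40 * β)
  have hlt : n < 40 * β * (s + 1) := Nat.lt_mul_div_succ n (by omega)
  rcases Nat.eq_zero_or_pos s with hs0 | hspos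
  · -- few rows: `n < 40β`, and `|S| ≥ n²` already suffices
    rw [hs0] at hlt
    calc n ^ 3 = n * (n * n) := by ring
      _ ≤ (40 * β) * Fintype.card S := Nat.mul_le_mul (by omega) hS2
      _ = 120 * m ^ 5 * Fintype.card S := by rw [hβ]; ring
      _ ≤ 115200 * m ^ 10 * Fintype.card S := by gcongr; norm_num
  -- the three bad-cell sets of the good base triple
  set B₁ : Finset (Fin n × Fin n) := Finset.univ.filter fun p : Fin n × Fin n =>
      R.φ p.1 j₀ p.2 - R.φ p.1 j₀ k₀ - R.φ i₀ j₀ p.2 + R.φ i₀ j₀ k₀ ≠ 0 with hB₁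
  set B₂ : Finset (Fin n × Fin n) := Finset.univ.filter fun p : Fin n × Fin n =>
      R.ψ i₀ p.1 p.2 - R.ψ i₀ p.1 k₀ - R.ψ i₀ j₀ p.2 + R.ψ i₀ j₀ k₀ ≠ 0 with hB₂
  set B₃ : Finset (Fin n × Fin n) := Finset.univ.filter fun p : Fin n × Fin n =>
      (R.ψ p.1 p.2 k₀ - R.φ p.1 p.2 k₀) - (R.ψ p.1 j₀ k₀ - R.φ p.1 j₀ k₀)
        - (R.ψ i₀ p.2 k₀ - R.φ i₀ p.2 k₀) + (R.ψ i₀ j₀ k₀ - R.φ i₀ j₀ k₀) ≠ 0 with hB₃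
  -- rows and columns through the base indices are clean (degenerate rectangles)
  have e1 : ∀ k, (i₀, k) ∉ B₁ := fun k => by
    simp only [hB₁, Finset.mem_filter, Finset.mem_univ, true_and, not_not]; abel
  have e1' : ∀ i, (i, k₀) ∉ B₁ := fun i => by
    simp only [hB₁, Finset.mem_filter, Finset.mem_univ, true_and, not_not]; abel
  have e2 : ∀ k, (j₀, k) ∉ B₂ := fun k => by
    simp only [hB₂, Finset.mem_filter, Finset.mem_univ, true_and, not_not]; abel
  have e2' : ∀ j, (j, k₀) ∉ B₂ := fun j => by
    simp only [hB₂, Finset.mem_filter, Finset.mem_univ, true_and, not_not]; abel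
  have e3 : ∀ j, (i₀, j) ∉ B₃ := fun j => by
    simp only [hB₃, Finset.mem_filter, Finset.mem_univ, true_and, not_not]; abel
  have e3' : ∀ i, (i, j₀) ∉ B₃ := fun i => by
    simp only [hB₃, Finset.mem_filter, Finset.mem_univ, true_and, not_not]; abel
  -- availability for the cleaning with `L = 10β`
  have havail : (10 * β + 1) * (s + s * (10 * β)) + (B₁.card + B₂.card + B₃.card)
      ≤ (10 * β + 1) * Fintype.card (Fin n) := by
    rw [Fintype.card_fin]
    have hg : B₁.card + B₂.card + B₃.card ≤ β * n := by rw [hβ]; exact hgood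
    have h1 : (10 * β + 1) * (s + s * (10 * β)) ≤ 121 * β * (β * s) := by
      have : 10 * β + 1 ≤ 11 * β := by omega
      calc (10 * β + 1) * (s + s * (10 * β)) = (10 * β + 1) * (10 * β + 1) * s := by ring
        _ ≤ (11 * β) * (11 * β) * s := by gcongr
        _ = 121 * β * (β * s) := by ring
    have h2 : 40 * (121 * β * (β * s)) ≤ 40 * (4 * β * n) := by
      calc 40 * (121 * β * (β * s)) = 121 * β * (40 * β * s) := by ring
        _ ≤ 121 * β * n := Nat.mul_le_mul_left _ h40
        _ ≤ 40 * (4 * β * n) := by nlinarith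
    have h3 := Nat.le_of_mul_le_mul_left h2 (by norm_num : 0 < 40)
    nlinarith
  obtain ⟨I', J', K', hi₀, hj₀, -, hI, hJ, hK, c1, c2, c3⟩ :=
    cleaning B₁ B₂ B₃ i₀ j₀ k₀ e1 e1' e2 e2' e3 e3' s (10 * β) hspos havail
  rw [Fintype.card_fin] at hK
  -- the three slices through the base triple are flat on the boxes
  have R1 : ∀ i ∈ I', ∀ k ∈ K', R.φ i j₀ k - R.φ i j₀ k₀ = R.φ i₀ j₀ k - R.φ i₀ j₀ k₀ := by
    intro i hi k hk
    have h := c1 i hi k hk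
    simp only [hB₁, Finset.mem_filter, Finset.mem_univ, true_and, not_not] at h
    exact eq_of_sub_eq_sub h (by abel)
  have R2 : ∀ j ∈ J', ∀ k ∈ K', R.ψ i₀ j k - R.ψ i₀ j k₀ = R.ψ i₀ j₀ k - R.ψ i₀ j₀ k₀ := by
    intro j hj k hk
    have h := c2 j hj k hk
    simp only [hB₂, Finset.mem_filter, Finset.mem_univ, true_and, not_not] at h
    exact eq_of_sub_eq_sub h (by abel)
  have R3 : ∀ i ∈ I', ∀ j ∈ J', (R.ψ i j k₀ - R.φ i j k₀) - (R.ψ i j₀ k₀ - R.φ i j₀ k₀)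
      = (R.ψ i₀ j k₀ - R.φ i₀ j k₀) - (R.ψ i₀ j₀ k₀ - R.φ i₀ j₀ k₀) := by
    intro i hi j hj
    have h := c3 i hi j hj
    simp only [hB₃, Finset.mem_filter, Finset.mem_univ, true_and, not_not] at h
    exact eq_of_sub_eq_sub h (by abel)
  -- part I: the box embeds into `S`
  have hbox := card_box_le_of_flat_slices R.sm R.sm_add R.sm_zero R.a R.b R.d R.φ R.ψ R.eqn R.real
    I' J' K' hi₀ hj₀ R1 R2 R3
  rw [hI, hJ] at hbox
  -- arithmetic: `n ≤ 80βs`, `n ≤ 2|K'|`, `s²|K'| ≤ |S|`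
  have hK2 : n ≤ 2 * K'.card := by nlinarith
  have h80 : 40 * β * (s + 1) ≤ 80 * β * s := by nlinarith
  calc n ^ 3 = n * n * n := by ring
    _ ≤ (40 * β * (s + 1)) * (40 * β * (s + 1)) * (2 * K'.card) := by gcongr
    _ ≤ (80 * β * s) * (80 * β * s) * (2 * K'.card) := by gcongr
    _ = 12800 * β ^ 2 * (s * s * K'.card) := by ring
    _ ≤ 12800 * β ^ 2 * Fintype.card S := by gcongr
    _ = 115200 * m ^ 10 * Fintype.card S := by rw [hβ]; ring

end TwistedRealization

end Summit.MatrixMultiplication.MatrixMultiplication.Theorems.TwistedTPP
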